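import Mathlib
import Literature.Analysis.FluidPDE.ClassicalSolution
import HarnessLib

/-!
# Crux `NoFrozenEddyCollapse` (stmt-NavierStokesRegularity-1431), line `SketchIdeator1`:
  stub `stub_quietFrame` — REDUCTION of the quiet weight to the energy rate gap

Helper file (lands `--supports stmt-NavierStokesRegularity-1431`) for the registered stub
`stub_quietFrame` of the skeleton `NoFrozenEddyCollapse` (card `shell-balance-edge-torsion`).
The stub asks for a `C¹` centre path `ξ'` on `(T₀, T)` along which the QUIET WEIGHT
`ρ(t) = (T−t)^{−α}/L · e(t) + ‖ξ̇'(t)‖/L · √(e(t))`, `L = ℓ√(ν(T−t))`,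
`e(t) = ∫_{B_R} ‖(T−t)^α u(t, ξ'(t) + L y) − U(y)‖² dy`, is integrable.  Its decomposition is
(i) recentring (implicit function theorem), (ii) the MODULATION BOUND
`‖ξ̇'(t)‖ ≤ C (T−t)^{−α} (√(e(t)) + √ν (T−t)^{α−1/2})`, (iii) the ENERGY RATE GAP
`∫^T (T−t)^{−α}/L · e(t) dt < ∞` (the crux's open difficulty).  This file proves the sorry-free
part "(ii) ∧ (iii) ⇒ ρ integrable", valid exactly because `α > 1/2`:

* `integrableOn_quietWeight_of_modulation` (abstract real analysis): for any `e ≥ 0` and any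
  `m` with `‖m‖ ≤ C (T−t)^{−α}(√e + √ν (T−t)^{α−1/2})` on `(T₀,T)`, integrability of
  `(T−t)^{−α}/L · e` implies integrability of `(T−t)^{−α}/L · e + ‖m‖/L · √e`.  Proof: the frame
  part is `≤ C (T−t)^{−α}/L · e + (C/ℓ) √e/(T−t)` (since `(T−t)^{−α}(T−t)^{α−1/2} = (T−t)^{−1/2}`),
  and by AM–GM `√e/(T−t) ≤ ½[(T−t)^{−α}/L · e + L/((T−t)^{−α}(T−t)²)]` with
  `L (T−t)^{α}/(T−t)² = ℓ√ν (T−t)^{α−3/2}`, integrable on `(T₀,T)` iff `α > 1/2`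
  (`intervalIntegral.intervalIntegrable_rpow'`).
* `continuousOn_frameDeviation`: for `u` jointly continuous on `[0,T) × ℝ³`, `U` continuous and a
  continuous frame `ξ'`, `t ↦ e(t)` is continuous on `(T₀, T)` (dominated convergence on the ball,
  `MeasureTheory.continuousAt_of_dominated`, bound from compactness of `[a,b] × closedBall 0 R`).
* `integrableOn_quietWeight_of_energyRate`: the two combined in the vocabulary of the stub
  (classical solution, `C¹` frame): modulation bound (ii) + energy rate (iii) ⇒ the weight of
  `stub_quietFrame` is integrable on `(T₀, T)`.

What is NOT here: (i), the derivation of (ii) from the centring identity, and (iii) itself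
(see the companion note `StubQuietFrame.md` of the line folder).  Mathlib + `ClassicalSolution`.
-/

noncomputable section

open MeasureTheory Set Filter Topology Metric Function

namespace Summit.NavierStokesRegularity.NavierStokesRegularity.Theorems.NoFrozenEddyCollapse.ShellBalanceEdgeTorsion

open Literature.Analysis.FluidPDE

/-! ### The abstract time lemma: frame part ≤ energy part + integrable, for `α > 1/2` -/

/-- AM–GM in the form used below: `r/s² ≤ ½ (a r²/(k s) + k/(a s³))` for `a, s, k > 0`
(the difference is `(a r s − k)²/(2 k a s³) ≥ 0`). -/
private theorem amgm_aux {a s k : ℝ} (r : ℝ) (ha : 0 < a) (hs : 0 < s) (hk : 0 < k) :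
    r / s ^ 2 ≤ (a * r ^ 2 / (k * s) + k / (a * s ^ 3)) / 2 := by
  have h : (a * r ^ 2 / (k * s) + k / (a * s ^ 3)) / 2 - r / s ^ 2 =
      (a * r * s - k) ^ 2 / (2 * k * a * s ^ 3) := by
    field_simp
    ring
  have h2 : 0 ≤ (a * r * s - k) ^ 2 / (2 * k * a * s ^ 3) := by positivity
  linarith [h2, h]

/-- Pointwise domination of the quiet weight at one time, `τ = T − t > 0`: if
`0 ≤ M ≤ C τ^{−α} (√e + √ν τ^{α−1/2})` then
`τ^{−α}/(ℓ√(ντ)) e + M/(ℓ√(ντ)) √e ≤ (1 + C' + C'/(2ℓ)) τ^{−α}/(ℓ√(ντ)) e + (C'√ν/2) τ^{α−3/2}`,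
`C' = max C 0`.  Algebra: `τ^{−α} τ^{α−1/2} = 1/√τ`, `τ^{α−3/2} = τ^{α}/√τ³`, then `amgm_aux`
with `a = τ^{−α}`, `s = √τ`, `r = √e`, `k = ℓ√ν`. -/
private theorem quietWeight_pointwise {α ν ℓ C τ e M : ℝ} (hν : 0 < ν) (hℓ : 0 < ℓ)
    (hτ : 0 < τ) (he : 0 ≤ e) (hM0 : 0 ≤ M)
    (hM : M ≤ C * τ ^ (-α) * (Real.sqrt e + Real.sqrt ν * τ ^ (α - 1 / 2))) :
    ‖τ ^ (-α) / (ℓ * Real.sqrt (ν * τ)) * e + M / (ℓ * Real.sqrt (ν * τ)) * Real.sqrt e‖ ≤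
      (1 + max C 0 + max C 0 / (2 * ℓ)) * (τ ^ (-α) / (ℓ * Real.sqrt (ν * τ)) * e) +
        max C 0 * Real.sqrt ν / 2 * τ ^ (α - 3 / 2) := by
  set C' := max C 0 with hC'
  have hC'0 : 0 ≤ C' := le_max_right _ _
  set a := τ ^ (-α) with ha
  set s := Real.sqrt τ with hs
  set r := Real.sqrt e with hr
  set q := Real.sqrt ν with hq
  have ha0 : 0 < a := Real.rpow_pos_of_pos hτ _
  have hs0 : 0 < s := Real.sqrt_pos.2 hτ
  have hr0 : 0 ≤ r := Real.sqrt_nonneg _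
  have hq0 : 0 < q := Real.sqrt_pos.2 hν
  have hk0 : 0 < ℓ * q := mul_pos hℓ hq0
  have he' : e = r ^ 2 := by rw [hr, Real.sq_sqrt he]
  have hsν : Real.sqrt (ν * τ) = q * s := by rw [hq, hs, Real.sqrt_mul hν.le]
  have hA : τ ^ α = a⁻¹ := by rw [ha, Real.rpow_neg hτ.le, inv_inv]
  have hS : τ ^ (1 / 2 : ℝ) = s := by rw [hs, Real.sqrt_eq_rpow]
  have F1 : τ ^ (α - 1 / 2) = a⁻¹ / s := by rw [Real.rpow_sub hτ, hA, hS]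
  have hS3 : τ ^ (3 / 2 : ℝ) = s ^ 3 := by
    rw [show (3 / 2 : ℝ) = (1 / 2 : ℝ) * 3 by norm_num, Real.rpow_mul hτ.le, hS]
    exact Real.rpow_ofNat s 3
  have F2 : τ ^ (α - 3 / 2) = a⁻¹ / s ^ 3 := by rw [Real.rpow_sub hτ, hA, hS3]
  -- upgrade the modulation bound to the nonnegative constant `C'`
  have hX : 0 ≤ a * (r + q * (a⁻¹ / s)) := by positivity
  have hM' : M ≤ C' * a * (r + q * (a⁻¹ / s)) := by
    rw [F1] at hM
    calc M ≤ C * a * (r + q * (a⁻¹ / s)) := hM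
      _ = C * (a * (r + q * (a⁻¹ / s))) := by ring
      _ ≤ C' * (a * (r + q * (a⁻¹ / s))) := mul_le_mul_of_nonneg_right (le_max_left _ _) hX
      _ = C' * a * (r + q * (a⁻¹ / s)) := by ring
  rw [hsν, F2, he']
  have hnn : 0 ≤ a / (ℓ * (q * s)) * r ^ 2 + M / (ℓ * (q * s)) * r := by positivity
  rw [Real.norm_of_nonneg hnn]
  -- replace `M` by its bound
  have hMr : M / (ℓ * (q * s)) * r ≤ C' * a * (r + q * (a⁻¹ / s)) / (ℓ * (q * s)) * r := by
    apply mul_le_mul_of_nonneg_right _ hr0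
    exact div_le_div_of_nonneg_right hM' (by positivity)
  -- the AM–GM remainder
  have key := amgm_aux r ha0 hs0 hk0
  have expand : (1 + C' + C' / (2 * ℓ)) * (a / (ℓ * (q * s)) * r ^ 2) + C' * q / 2 * (a⁻¹ / s ^ 3) -
      (a / (ℓ * (q * s)) * r ^ 2 + C' * a * (r + q * (a⁻¹ / s)) / (ℓ * (q * s)) * r) =
      C' / ℓ * ((a * r ^ 2 / (ℓ * q * s) + ℓ * q / (a * s ^ 3)) / 2 - r / s ^ 2) := by
    field_simp
    ring
  have hrem : 0 ≤ C' / ℓ * ((a * r ^ 2 / (ℓ * q * s) + ℓ * q / (a * s ^ 3)) / 2 - r / s ^ 2) :=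
    mul_nonneg (div_nonneg hC'0 hℓ.le) (sub_nonneg.2 key)
  linarith [hMr, expand, hrem]

/-- **Frame part ≤ energy part + integrable (abstract time lemma; the only place `α > 1/2` enters
the quiet branch).**  Let `e ≥ 0` on `(T₀, T)` and `m : ℝ → ℝ³` be (a.e. strongly) measurable, and
suppose the MODULATION BOUND `‖m(t)‖ ≤ C (T−t)^{−α} (√(e t) + √ν (T−t)^{α−1/2})` on `(T₀, T)`.
If the energy part `(T−t)^{−α}/(ℓ√(ν(T−t))) · e(t)` is integrable on `(T₀, T)`, then so is the full
quiet weight `(T−t)^{−α}/(ℓ√(ν(T−t))) · e(t) + ‖m(t)‖/(ℓ√(ν(T−t))) · √(e(t))`.  Indeed the frame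
part is at most `C'·(energy part) + (C'/ℓ) √e/(T−t)`, and
`√e/(T−t) ≤ ½[(energy part) + ℓ√ν (T−t)^{α−3/2}]` (AM–GM), the last function being integrable
near `T` because `α − 3/2 > −1`. -/
theorem integrableOn_quietWeight_of_modulation
    {ν T T₀ α ℓ C : ℝ} {e : ℝ → ℝ} {m : ℝ → EuclideanSpace ℝ (Fin 3)}
    (hν : 0 < ν) (hT₀T : T₀ < T) (hα : 1 / 2 < α) (hℓ : 0 < ℓ)
    (he0 : ∀ t ∈ Set.Ioo T₀ T, 0 ≤ e t)
    (hem : AEStronglyMeasurable e (volume.restrict (Set.Ioo T₀ T)))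
    (hmm : AEStronglyMeasurable m (volume.restrict (Set.Ioo T₀ T)))
    (hE : IntegrableOn (fun t => (T - t) ^ (-α) / (ℓ * Real.sqrt (ν * (T - t))) * e t)
      (Set.Ioo T₀ T))
    (hmod : ∀ t ∈ Set.Ioo T₀ T,
      ‖m t‖ ≤ C * (T - t) ^ (-α) * (Real.sqrt (e t) + Real.sqrt ν * (T - t) ^ (α - 1 / 2))) :
    IntegrableOn (fun t => (T - t) ^ (-α) / (ℓ * Real.sqrt (ν * (T - t))) * e t +
        ‖m t‖ / (ℓ * Real.sqrt (ν * (T - t))) * Real.sqrt (e t)) (Set.Ioo T₀ T) := by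
  set C' := max C 0 with hC'
  -- the integrable majorant
  have hpow : IntegrableOn (fun t => (T - t) ^ (α - 3 / 2)) (Set.Ioo T₀ T) := by
    have h1 : IntervalIntegrable (fun x => x ^ (α - 3 / 2)) volume (T - T₀) 0 :=
      intervalIntegral.intervalIntegrable_rpow' (by linarith)
    have h2 := h1.comp_sub_left T
    rw [sub_sub_cancel, sub_zero] at h2
    exact (intervalIntegrable_iff_integrableOn_Ioo_of_le hT₀T.le).1 h2
  have hgi : IntegrableOn (fun t => (1 + C' + C' / (2 * ℓ)) *
      ((T - t) ^ (-α) / (ℓ * Real.sqrt (ν * (T - t))) * e t) +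
      C' * Real.sqrt ν / 2 * (T - t) ^ (α - 3 / 2)) (Set.Ioo T₀ T) :=
    (hE.const_mul _).add (hpow.const_mul _)
  -- measurability of the weight
  have hmeas : AEStronglyMeasurable (fun t => (T - t) ^ (-α) / (ℓ * Real.sqrt (ν * (T - t))) * e t +
      ‖m t‖ / (ℓ * Real.sqrt (ν * (T - t))) * Real.sqrt (e t))
      (volume.restrict (Set.Ioo T₀ T)) := by
    refine hE.aestronglyMeasurable.add ?_
    have hm1 : AEMeasurable (fun t => ‖m t‖) (volume.restrict (Set.Ioo T₀ T)) :=
      hmm.norm.aemeasurable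
    have hd : Measurable (fun t : ℝ => ℓ * Real.sqrt (ν * (T - t))) := by fun_prop
    have hsq : AEMeasurable (fun t => Real.sqrt (e t)) (volume.restrict (Set.Ioo T₀ T)) :=
      Real.continuous_sqrt.measurable.comp_aemeasurable hem.aemeasurable
    exact ((hm1.div hd.aemeasurable).mul hsq).aestronglyMeasurable
  -- domination
  refine Integrable.mono' hgi hmeas (ae_restrict_of_forall_mem measurableSet_Ioo fun t ht => ?_)
  exact quietWeight_pointwise hν hℓ (sub_pos.2 ht.2) (he0 t ht) (norm_nonneg _) (hmod t ht)

/-! ### Continuity of the frame deviation `t ↦ ∫_{B_R} ‖V'(t) − U‖²` -/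

/-- **Continuity of the eddy-frame deviation.**  If `u` is jointly continuous on `[0,T) × ℝ³`,
`U` is continuous and the frame `ξ'` is continuous on `(T₀, T)`, `0 ≤ T₀`, then
`t ↦ ∫_{B_R} ‖(T−t)^α u(t, ξ'(t) + ℓ√(ν(T−t)) y) − U(y)‖² dy` is continuous on `(T₀, T)`:
the integrand is jointly continuous on `(T₀,T) × ℝ³`, hence bounded on `[a,b] × closedBall 0 R`
for `T₀ < a < t₀ < b < T`, and dominated convergence on the (finite-measure) ball applies. -/
theorem continuousOn_frameDeviation
    {ν T T₀ α ℓ R : ℝ} {u : ℝ → EuclideanSpace ℝ (Fin 3) → EuclideanSpace ℝ (Fin 3)}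
    {U : EuclideanSpace ℝ (Fin 3) → EuclideanSpace ℝ (Fin 3)} {ξ' : ℝ → EuclideanSpace ℝ (Fin 3)}
    (hT₀ : 0 ≤ T₀)
    (hu : ContinuousOn (Function.uncurry u) (Set.Ico 0 T ×ˢ (Set.univ : Set (EuclideanSpace ℝ (Fin 3)))))
    (hU : Continuous U) (hξ : ContinuousOn ξ' (Set.Ioo T₀ T)) :
    ContinuousOn (fun t => ∫ y in Metric.ball (0 : EuclideanSpace ℝ (Fin 3)) R,
        ‖((T - t) ^ α) • u t (ξ' t + (ℓ * Real.sqrt (ν * (T - t))) • y) - U y‖ ^ 2)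
      (Set.Ioo T₀ T) := by
  -- joint continuity of the integrand on `(T₀,T) × ℝ³`
  have hF : ContinuousOn (fun z : ℝ × EuclideanSpace ℝ (Fin 3) =>
      ‖((T - z.1) ^ α) • u z.1 (ξ' z.1 + (ℓ * Real.sqrt (ν * (T - z.1))) • z.2) - U z.2‖ ^ 2)
      (Set.Ioo T₀ T ×ˢ Set.univ) := by
    have h1 : ContinuousOn (fun z : ℝ × EuclideanSpace ℝ (Fin 3) =>
        (z.1, ξ' z.1 + (ℓ * Real.sqrt (ν * (T - z.1))) • z.2)) (Set.Ioo T₀ T ×ˢ Set.univ) := by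
      have hξ1 : ContinuousOn (fun z : ℝ × EuclideanSpace ℝ (Fin 3) => ξ' z.1)
          (Set.Ioo T₀ T ×ˢ Set.univ) :=
        hξ.comp continuousOn_fst fun z hz => hz.1
      have hrest : Continuous (fun z : ℝ × EuclideanSpace ℝ (Fin 3) =>
          (ℓ * Real.sqrt (ν * (T - z.1))) • z.2) := by fun_prop
      exact continuousOn_fst.prodMk (hξ1.add hrest.continuousOn)
    have h2 : Set.MapsTo (fun z : ℝ × EuclideanSpace ℝ (Fin 3) =>
        (z.1, ξ' z.1 + (ℓ * Real.sqrt (ν * (T - z.1))) • z.2))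
        (Set.Ioo T₀ T ×ˢ Set.univ) (Set.Ico 0 T ×ˢ Set.univ) := fun z hz =>
      ⟨⟨hT₀.trans hz.1.1.le, hz.1.2⟩, Set.mem_univ _⟩
    have h3 : ContinuousOn (fun z : ℝ × EuclideanSpace ℝ (Fin 3) =>
        u z.1 (ξ' z.1 + (ℓ * Real.sqrt (ν * (T - z.1))) • z.2)) (Set.Ioo T₀ T ×ˢ Set.univ) :=
      hu.comp h1 h2
    have h4 : ContinuousOn (fun z : ℝ × EuclideanSpace ℝ (Fin 3) => (T - z.1) ^ α)
        (Set.Ioo T₀ T ×ˢ Set.univ) :=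
      ContinuousOn.rpow_const (by fun_prop) fun z hz => Or.inl (sub_pos.2 hz.1.2).ne'
    have h5 : ContinuousOn (fun z : ℝ × EuclideanSpace ℝ (Fin 3) => U z.2)
        (Set.Ioo T₀ T ×ˢ Set.univ) := (hU.comp continuous_snd).continuousOn
    exact ((h4.smul h3).sub h5).norm.pow 2
  -- continuity at each point of the open interval, by dominated convergence on the ball
  intro t₀ ht₀
  obtain ⟨a, ha, hat⟩ := exists_between ht₀.1
  obtain ⟨b, htb, hb⟩ := exists_between ht₀.2
  have hsub : Set.Icc a b ⊆ Set.Ioo T₀ T := fun t ht => ⟨ha.trans_le ht.1, ht.2.trans_lt hb⟩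
  have hK : IsCompact (Set.Icc a b ×ˢ Metric.closedBall (0 : EuclideanSpace ℝ (Fin 3)) R) :=
    isCompact_Icc.prod (isCompact_closedBall 0 R)
  obtain ⟨M, hM⟩ := hK.exists_bound_of_continuousOn
    (hF.mono (Set.prod_mono hsub (Set.subset_univ _)))
  have hnhds : Set.Ioo a b ∈ 𝓝 t₀ := Ioo_mem_nhds hat htb
  have key : ContinuousAt (fun t => ∫ y in Metric.ball (0 : EuclideanSpace ℝ (Fin 3)) R,
      ‖((T - t) ^ α) • u t (ξ' t + (ℓ * Real.sqrt (ν * (T - t))) • y) - U y‖ ^ 2) t₀ := by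
    refine continuousAt_of_dominated (bound := fun _ => M) ?_ ?_ ?_ ?_
    · filter_upwards [hnhds] with t ht
      have hslice : Continuous (fun y : EuclideanSpace ℝ (Fin 3) =>
          ‖((T - t) ^ α) • u t (ξ' t + (ℓ * Real.sqrt (ν * (T - t))) • y) - U y‖ ^ 2) :=
        hF.comp_continuous (f := fun y : EuclideanSpace ℝ (Fin 3) => (t, y)) (by fun_prop)
          fun y => ⟨hsub ⟨ht.1.le, ht.2.le⟩, Set.mem_univ _⟩
      exact hslice.aestronglyMeasurable
    · filter_upwards [hnhds] with t ht
      refine ae_restrict_of_forall_mem measurableSet_ball fun y hy => ?_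
      exact hM (t, y) ⟨⟨ht.1.le, ht.2.le⟩, Metric.ball_subset_closedBall hy⟩
    · exact integrableOn_const
        (measure_ball_lt_top (μ := volume) (x := (0 : EuclideanSpace ℝ (Fin 3))) (r := R)).ne
    · refine Filter.Eventually.of_forall fun y => ?_
      have hg : ContinuousOn (fun t : ℝ => ((t, y) : ℝ × EuclideanSpace ℝ (Fin 3)))
          (Set.Ioo T₀ T) := by
        fun_prop
      have hmaps : Set.MapsTo (fun t : ℝ => ((t, y) : ℝ × EuclideanSpace ℝ (Fin 3)))
          (Set.Ioo T₀ T) (Set.Ioo T₀ T ×ˢ (Set.univ : Set (EuclideanSpace ℝ (Fin 3)))) :=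
        fun t ht => Set.mk_mem_prod ht (Set.mem_univ y)
      have hline := hF.comp hg hmaps
      exact hline.continuousAt (Ioo_mem_nhds ht₀.1 ht₀.2)
  exact key.continuousWithinAt

/-! ### The reduction in the vocabulary of `stub_quietFrame` -/

/-- **Quiet weight from modulation bound + energy rate (reduction of `stub_quietFrame`).**
For a classical NS solution `(u, p)` on `[0, T)`, a continuous profile `U`, `α > 1/2`, `ℓ, ν > 0`,
and a `C¹` frame `ξ'` on `(T₀, T)`, `0 ≤ T₀ < T`, write `L = ℓ√(ν(T−t))`,
`V'(t,y) = (T−t)^α u(t, ξ'(t) + L y)`, `e(t) = ∫_{B_R} ‖V'(t) − U‖²`.  If the frame obeys the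
MODULATION BOUND `‖ξ̇'(t)‖ ≤ C (T−t)^{−α} (√(e(t)) + √ν (T−t)^{α−1/2})` on `(T₀, T)` (step (ii):
for a centred frame this follows from `d/dt ∫⟪V' − U, ∂ⱼU⟫ = 0` and the rescaled equation) and the
ENERGY RATE `∫_{(T₀,T)} (T−t)^{−α}/L · e(t) dt < ∞` holds (step (iii): the crux's open rate gap),
then the quiet weight `(T−t)^{−α}/L · e + ‖ξ̇'‖/L · √e` of `stub_quietFrame` is integrable on
`(T₀, T)`.  Uses only the joint continuity of `u` on `[0,T) × ℝ³`. -/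
theorem integrableOn_quietWeight_of_energyRate :
    ∀ (ν T T₀ α ℓ R C : ℝ) (u : ℝ → EuclideanSpace ℝ (Fin 3) → EuclideanSpace ℝ (Fin 3))
      (p : ℝ → EuclideanSpace ℝ (Fin 3) → ℝ)
      (U : EuclideanSpace ℝ (Fin 3) → EuclideanSpace ℝ (Fin 3)) (ξ' dξ' : ℝ → EuclideanSpace ℝ (Fin 3)),
      0 < ν → 0 ≤ T₀ → T₀ < T → 1 / 2 < α → 0 < ℓ →
      IsClassicalNSSolutionOn (Set.Ico 0 T) ν 0 u p → Continuous U →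
      (∀ t ∈ Set.Ioo T₀ T, HasDerivAt ξ' (dξ' t) t) → ContinuousOn dξ' (Set.Ioo T₀ T) →
      (∀ t ∈ Set.Ioo T₀ T, ‖dξ' t‖ ≤ C * (T - t) ^ (-α) *
        (Real.sqrt (∫ y in Metric.ball (0 : EuclideanSpace ℝ (Fin 3)) R,
            ‖((T - t) ^ α) • u t (ξ' t + (ℓ * Real.sqrt (ν * (T - t))) • y) - U y‖ ^ 2) +
          Real.sqrt ν * (T - t) ^ (α - 1 / 2))) →
      IntegrableOn (fun t : ℝ => (T - t) ^ (-α) / (ℓ * Real.sqrt (ν * (T - t))) *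
        (∫ y in Metric.ball (0 : EuclideanSpace ℝ (Fin 3)) R,
          ‖((T - t) ^ α) • u t (ξ' t + (ℓ * Real.sqrt (ν * (T - t))) • y) - U y‖ ^ 2))
        (Set.Ioo T₀ T) →
      IntegrableOn (fun t : ℝ =>
        (T - t) ^ (-α) / (ℓ * Real.sqrt (ν * (T - t))) *
            (∫ y in Metric.ball (0 : EuclideanSpace ℝ (Fin 3)) R,
              ‖((T - t) ^ α) • u t (ξ' t + (ℓ * Real.sqrt (ν * (T - t))) • y) - U y‖ ^ 2) +
          ‖dξ' t‖ / (ℓ * Real.sqrt (ν * (T - t))) *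
            Real.sqrt (∫ y in Metric.ball (0 : EuclideanSpace ℝ (Fin 3)) R,
              ‖((T - t) ^ α) • u t (ξ' t + (ℓ * Real.sqrt (ν * (T - t))) • y) - U y‖ ^ 2))
        (Set.Ioo T₀ T) := by
  intro ν T T₀ α ℓ R C u p U ξ' dξ' hν hT₀ hT₀T hα hℓ hns hU hder hdξ hmod hE
  have hξc : ContinuousOn ξ' (Set.Ioo T₀ T) := fun t ht =>
    (hder t ht).continuousAt.continuousWithinAt
  have hu : ContinuousOn (Function.uncurry u)
      (Set.Ico 0 T ×ˢ (Set.univ : Set (EuclideanSpace ℝ (Fin 3)))) :=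
    hns.smooth_velocity.continuousOn
  have hec := continuousOn_frameDeviation (ν := ν) (T := T) (α := α) (ℓ := ℓ) (R := R) hT₀ hu hU hξc
  refine integrableOn_quietWeight_of_modulation hν hT₀T hα hℓ (fun t _ => ?_)
    (hec.aestronglyMeasurable measurableSet_Ioo) (hdξ.aestronglyMeasurable measurableSet_Ioo)
    hE hmod
  exact integral_nonneg fun y => sq_nonneg _

/-! ### Rate-free inputs of steps (i)–(ii): translation non-degeneracy and `e(t) → 0`
(appended by the `stub_quietFrame` worker; Mathlib only) -/

/-- **Translation non-degeneracy of a compactly supported profile (Gram lemma for the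
recentring step (i) of `stub_quietFrame`).**  If `U : ℝ³ → ℝ³` is `C¹`, compactly supported and
`U ≠ 0`, then for every direction `v ≠ 0`, `0 < ∫ ‖DU(y) v‖² dy`; equivalently the Gram matrix
`M_{jk} = ∫ ⟪∂_jU, ∂_kU⟫` of the translation modes is positive definite (`Mv·v = ∫‖DU v‖²`).
Proof: otherwise `DU(y)v = 0` for all `y` (continuous nonnegative integrand with zero integral),
so `U` is constant on every line `y + ℝv`, and such a line leaves the compact `tsupport U`. -/
theorem integral_norm_fderiv_apply_sq_pos
    {U : EuclideanSpace ℝ (Fin 3) → EuclideanSpace ℝ (Fin 3)} (hU : ContDiff ℝ 1 U)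
    (hUc : HasCompactSupport U) (hne : U ≠ 0) {v : EuclideanSpace ℝ (Fin 3)} (hv : v ≠ 0) :
    0 < ∫ y, ‖fderiv ℝ U y v‖ ^ 2 := by
  have hcont : Continuous fun y => ‖fderiv ℝ U y v‖ ^ 2 :=
    ((hU.continuous_fderiv one_ne_zero).clm_apply continuous_const).norm.pow 2
  have hsupp : HasCompactSupport fun y => ‖fderiv ℝ U y v‖ ^ 2 :=
    (hUc.fderiv (𝕜 := ℝ)).mono fun y hy => by
      rw [mem_support] at hy ⊢
      contrapose! hy
      simp [hy]
  have hint : Integrable (fun y => ‖fderiv ℝ U y v‖ ^ 2) := hcont.integrable_of_hasCompactSupport hsupp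
  have hnn : 0 ≤ ∫ y, ‖fderiv ℝ U y v‖ ^ 2 := integral_nonneg fun y => sq_nonneg _
  refine hnn.lt_of_ne fun h0 => hne ?_
  -- zero integral of a continuous nonnegative function: `DU(y) v = 0` everywhere
  have hae : (fun y => ‖fderiv ℝ U y v‖ ^ 2) =ᵐ[volume] 0 :=
    (integral_eq_zero_iff_of_nonneg (fun y => sq_nonneg _) hint).1 h0.symm
  have hzero : ∀ y, fderiv ℝ U y v = 0 := by
    have h := (hcont.ae_eq_iff_eq volume continuous_const).1 hae
    intro y
    have hy : ‖fderiv ℝ U y v‖ ^ 2 = 0 := congr_fun h y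
    rwa [sq_eq_zero_iff, norm_eq_zero] at hy
  -- `U` is constant along every line in direction `v`
  have hline : ∀ (y : EuclideanSpace ℝ (Fin 3)) (s : ℝ), U (y + s • v) = U y := by
    intro y s
    have hd : ∀ r : ℝ, HasDerivAt (fun r : ℝ => U (y + r • v)) (0 : EuclideanSpace ℝ (Fin 3)) r := by
      intro r
      have h1 : HasDerivAt (fun r : ℝ => y + r • v) v r := by
        simpa using ((hasDerivAt_id r).smul_const v).const_add y
      have h2 := ((hU.differentiable one_ne_zero) (y + r • v)).hasFDerivAt.comp_hasDerivAt r h1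
      simpa [Function.comp_def, hzero] using h2
    have hdiff : Differentiable ℝ fun r : ℝ => U (y + r • v) := fun r => (hd r).differentiableAt
    have hconst := is_const_of_deriv_eq_zero hdiff (fun r => (hd r).deriv) s 0
    simpa using hconst
  -- such a line leaves the compact support
  funext y
  obtain ⟨r, hr⟩ := hUc.isCompact.isBounded.subset_closedBall (0 : EuclideanSpace ℝ (Fin 3))
  have hvpos : 0 < ‖v‖ := norm_pos_iff.2 hv
  set s : ℝ := (|r| + ‖y‖ + 1) / ‖v‖ with hs
  have hs0 : 0 ≤ s := by positivity
  have hfar : y + s • v ∉ tsupport U := by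
    intro hmem
    have hle : ‖y + s • v‖ ≤ r := by simpa using hr hmem
    have hge : s * ‖v‖ - ‖y‖ ≤ ‖y + s • v‖ := by
      have := norm_sub_norm_le (s • v) (-y)
      rw [norm_smul, Real.norm_of_nonneg hs0, norm_neg, sub_neg_eq_add, add_comm] at this
      linarith
    have hsv : s * ‖v‖ = |r| + ‖y‖ + 1 := by rw [hs]; field_simp
    linarith [le_abs_self r]
  rw [← hline y s, image_eq_zero_of_notMem_tsupport hfar]
  rfl

/-- **The frame deviation tends to zero.**  If `V(t) → U` locally uniformly on `ℝ³` as `t ↑ T`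
then `e(t) = ∫_{B_R} ‖V(t) − U‖² → 0`: locally uniform convergence is uniform on the compact
`closedBall 0 R`, and `|∫_{B_R} ‖V(t)−U‖²| ≤ δ² · vol(B_R)` once `‖V(t) − U‖ < δ ≤ 1` there
(`norm_setIntegral_le_of_norm_le_const`; no measurability or continuity of the slices is needed).
This is the rate-free input `‖W(t)‖_{L²(B_R)} → 0` of steps (i)–(ii) of `stub_quietFrame`. -/
theorem tendsto_frameDeviation_zero {T R : ℝ}
    {V : ℝ → EuclideanSpace ℝ (Fin 3) → EuclideanSpace ℝ (Fin 3)}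
    {U : EuclideanSpace ℝ (Fin 3) → EuclideanSpace ℝ (Fin 3)}
    (hconv : TendstoLocallyUniformly V U (nhdsWithin T (Set.Iio T))) :
    Tendsto (fun t => ∫ y in Metric.ball (0 : EuclideanSpace ℝ (Fin 3)) R, ‖V t y - U y‖ ^ 2)
      (nhdsWithin T (Set.Iio T)) (nhds 0) := by
  have hunif : TendstoUniformlyOn V U (nhdsWithin T (Set.Iio T))
      (Metric.closedBall (0 : EuclideanSpace ℝ (Fin 3)) R) :=
    (tendstoLocallyUniformlyOn_iff_tendstoUniformlyOn_of_compact (isCompact_closedBall 0 R)).1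
      hconv.tendstoLocallyUniformlyOn
  rw [Metric.tendstoUniformlyOn_iff] at hunif
  rw [Metric.tendsto_nhds]
  intro ε hε
  set m : ℝ := volume.real (Metric.ball (0 : EuclideanSpace ℝ (Fin 3)) R) with hm
  have hm0 : 0 ≤ m := measureReal_nonneg
  set δ : ℝ := min 1 (ε / (2 * (m + 1))) with hδ
  have hδ0 : 0 < δ := lt_min one_pos (by positivity)
  have hδ1 : δ ≤ 1 := min_le_left _ _
  have hδ2 : δ ≤ ε / (2 * (m + 1)) := min_le_right _ _
  filter_upwards [hunif δ hδ0] with t ht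
  rw [Real.dist_eq, sub_zero]
  have hbound : ∀ y ∈ Metric.ball (0 : EuclideanSpace ℝ (Fin 3)) R, ‖‖V t y - U y‖ ^ 2‖ ≤ δ ^ 2 := by
    intro y hy
    have hlt : ‖V t y - U y‖ < δ := by
      rw [← dist_eq_norm, dist_comm]; exact ht y (Metric.ball_subset_closedBall hy)
    rw [Real.norm_of_nonneg (sq_nonneg _)]
    exact pow_le_pow_left₀ (norm_nonneg _) hlt.le 2
  calc |∫ y in Metric.ball (0 : EuclideanSpace ℝ (Fin 3)) R, ‖V t y - U y‖ ^ 2|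
      = ‖∫ y in Metric.ball (0 : EuclideanSpace ℝ (Fin 3)) R, ‖V t y - U y‖ ^ 2‖ := (Real.norm_eq_abs _).symm
    _ ≤ δ ^ 2 * m := norm_setIntegral_le_of_norm_le_const measure_ball_lt_top hbound
    _ ≤ δ * m := by
        apply mul_le_mul_of_nonneg_right _ hm0
        calc δ ^ 2 = δ * δ := sq δ
          _ ≤ δ * 1 := mul_le_mul_of_nonneg_left hδ1 hδ0.le
          _ = δ := mul_one δ
    _ ≤ ε / (2 * (m + 1)) * m := mul_le_mul_of_nonneg_right hδ2 hm0
    _ < ε := by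
        rw [div_mul_eq_mul_div, div_lt_iff₀ (by positivity)]
        nlinarith

end Summit.NavierStokesRegularity.NavierStokesRegularity.Theorems.NoFrozenEddyCollapse.ShellBalanceEdgeTorsion
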